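import Summits.QuantumFields.YangMills.Theorems.PencilRigidityWeakCouplingHypercubicLimitStubTransferRepresentation
import HarnessLib

/-!
# Slab functionals in sliced coordinates (line `Sketch` of crux `PencilRigidity.WeakCouplingHypercubicLimit`,
# stmt-QuantumFields-16120)

Two Wilson-theory bookkeeping lemmas for the transfer-matrix representation of REFLECTED slab pairs
(`reflectedPair_transferForm`, `stub_rpSpectralOfColdPressure`):

* `wilsonExpectation_sliced` — slicing the torus `(ℤ/(2S+1))⁴` across Euclidean time (T1 `stub_timeSlicing`): every
  Wilson expectation is the ratio of the sliced integral of the observable against the cyclic product of the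
  symmetrised one-step Boltzmann factors and the sliced partition function;
* `reflectedPair_cylinder` — the CYLINDER PROPERTY of a bounded measurable functional `Y` of the time slab `[1, r+2]`
  of `ℤ⁴` in sliced coordinates: there is a block observable `blk` of `r+2` consecutive slices and the `r+1` temporal
  link fields between them (measurable, bounded by `sup |Y|`) such that the time translate `Y ∘ τ_m ∘ lift` reads the
  slices `m+1, …, m+r+2`, and the link reflection `Y ∘ lift ∘ Θ_T` (`GaugeConfig.timeReflect`, `θ t = 1 − t`) reads the
  slices `0, −1, …, −(r+1)` in REVERSED order with the temporal links INVERTED.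

References: K. Osterwalder, E. Seiler, Ann. Phys. 110 (1978) §2; E. Seiler, LNP 159 (1982) Ch. 2. [folklore]
-/

noncomputable section

open scoped BigOperators Topology
open MeasureTheory Filter
open Literature.MathematicalPhysics.QuantumFieldTheory Literature.MathematicalPhysics.QuantumLattice

namespace Summit.QuantumFields.YangMills.Theorems.WeakCouplingHypercubicLimit.TraceNormColdPressure

/-- **Wilson expectations in sliced coordinates.**  For every measurable observable `Φ` of the torus
`(ℤ/(2S+1))⁴`, `∫ Φ dμ_{β} = (∫ Φ(asm p) ∏ₜ c(pₜ) dp) / (∫ ∏ₜ c(pₜ) dp)`, where `asm` assembles a configuration from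
its time slices `p.1 t` and temporal links `p.2 t`, and `c = e^{−β S₃/2} e^{−β S_tm} e^{−β S₃/2}` is the symmetrised
one-step Boltzmann factor (T1 `stub_timeSlicing` + `wilsonExpectation_eq_div_integral`). [folklore] -/
theorem wilsonExpectation_sliced :
    ∀ (G : Type) [Group G] [TopologicalSpace G] [IsTopologicalGroup G] [CompactSpace G]
      [MeasurableSpace G] [BorelSpace G] (r : LatticeRep G) (β : ℝ) (S : ℕ)
      (Φ : GaugeConfig 4 (2 * S + 1) G → ℝ), Measurable Φ →
      ∫ U, Φ U ∂(wilsonMeasure r.ρ β : Measure (GaugeConfig 4 (2 * S + 1) G)) =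
        (∫ p : (ZMod (2 * S + 1) → GaugeConfig 3 (2 * S + 1) G) × (ZMod (2 * S + 1) → Site 3 (2 * S + 1) → G),
            Φ (fun e : Edge 4 (2 * S + 1) =>
              (Fin.cons (p.2 (e.1 0) (Fin.tail e.1)) (fun i : Fin 3 => p.1 (e.1 0) (Fin.tail e.1, i)) : Fin 4 → G) e.2) *
            ∏ t : ZMod (2 * S + 1), (Real.exp (-(β * wilsonAction r.ρ (p.1 t) / 2)) *
              Real.exp (-(β * sliceTemporalAction r.ρ (p.1 t) (p.2 t) (p.1 (t + 1)))) * Real.exp (-(β * wilsonAction r.ρ (p.1 (t + 1)) / 2)))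
          ∂((Measure.pi fun _ : ZMod (2 * S + 1) => Measure.pi fun _ : Edge 3 (2 * S + 1) => haarProbability G).prod
            (Measure.pi fun _ : ZMod (2 * S + 1) => Measure.pi fun _ : Site 3 (2 * S + 1) => haarProbability G))) /
        ∫ p : (ZMod (2 * S + 1) → GaugeConfig 3 (2 * S + 1) G) × (ZMod (2 * S + 1) → Site 3 (2 * S + 1) → G),
            ∏ t : ZMod (2 * S + 1), (Real.exp (-(β * wilsonAction r.ρ (p.1 t) / 2)) *
              Real.exp (-(β * sliceTemporalAction r.ρ (p.1 t) (p.2 t) (p.1 (t + 1)))) * Real.exp (-(β * wilsonAction r.ρ (p.1 (t + 1)) / 2)))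
          ∂((Measure.pi fun _ : ZMod (2 * S + 1) => Measure.pi fun _ : Edge 3 (2 * S + 1) => haarProbability G).prod
            (Measure.pi fun _ : ZMod (2 * S + 1) => Measure.pi fun _ : Site 3 (2 * S + 1) => haarProbability G)) := by
  intro G _ _ _ _ _ _ r β S Φ hΦ
  haveI : SecondCountableTopology G :=
    (r.continuous.isClosedEmbedding r.injective).isEmbedding.secondCountableTopology
  obtain ⟨hasm, hact⟩ := stub_timeSlicing (2 * S + 1) G r.ρ
  have hnum : ∀ Ψ : GaugeConfig 4 (2 * S + 1) G → ℝ, Measurable Ψ →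
      ∫ U, Ψ U * Real.exp (-β * wilsonAction r.ρ U) ∂(Measure.pi fun _ : Edge 4 (2 * S + 1) => haarProbability G) =
        ∫ p : (ZMod (2 * S + 1) → GaugeConfig 3 (2 * S + 1) G) × (ZMod (2 * S + 1) → Site 3 (2 * S + 1) → G),
            Ψ (fun e : Edge 4 (2 * S + 1) =>
              (Fin.cons (p.2 (e.1 0) (Fin.tail e.1)) (fun i : Fin 3 => p.1 (e.1 0) (Fin.tail e.1, i)) : Fin 4 → G) e.2) *
            ∏ t : ZMod (2 * S + 1), (Real.exp (-(β * wilsonAction r.ρ (p.1 t) / 2)) *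
              Real.exp (-(β * sliceTemporalAction r.ρ (p.1 t) (p.2 t) (p.1 (t + 1)))) * Real.exp (-(β * wilsonAction r.ρ (p.1 (t + 1)) / 2)))
          ∂((Measure.pi fun _ : ZMod (2 * S + 1) => Measure.pi fun _ : Edge 3 (2 * S + 1) => haarProbability G).prod
            (Measure.pi fun _ : ZMod (2 * S + 1) => Measure.pi fun _ : Site 3 (2 * S + 1) => haarProbability G)) := by
    intro Ψ hΨ
    have hmeas : Measurable fun U : GaugeConfig 4 (2 * S + 1) G => Ψ U * Real.exp (-β * wilsonAction r.ρ U) :=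
      hΨ.mul (Real.measurable_exp.comp ((measurable_wilsonAction r.ρ r.continuous).const_mul (-β)))
    rw [← hasm.map_eq, integral_map hasm.measurable.aemeasurable hmeas.aestronglyMeasurable]
    refine integral_congr_ae (ae_of_all _ fun p => ?_)
    dsimp only
    rw [hact p.1 p.2, exp_neg_mul_sum_eq_prod]
  have h := wilsonExpectation_eq_div_integral (L := 2 * S + 1) (ρ := r.ρ) r.continuous β Φ
  unfold wilsonExpectation at h
  rw [h, hnum Φ hΦ]
  have h1 := hnum (fun _ => (1 : ℝ)) measurable_const
  simp only [one_mul] at h1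
  rw [h1]

/-- **Slab functionals in sliced coordinates (cylinder property).**  For a bounded measurable functional `Y` of
the time slab `[1, r+2]` of `ℤ⁴` (edges with `1 ≤ x₀` and `x₀ + [temporal] ≤ r+2`) there is a block observable `blk`
of `r+2` slices and `r+1` link fields, measurable and bounded by `sup |Y|`, such that on the torus `(ℤ/(2S+1))⁴`
(`r + 2 ≤ 2S`) assembled from a sliced configuration `q`: the translate `Y ∘ τ_m ∘ lift` reads the slices and links at the
times `m+1+i`, and the link reflection `Y ∘ lift ∘ Θ_T` reads the slices at the times `−i` and the INVERTED links at the
times `−(j+1)` (`DependsOn` + the arithmetic of small casts into `ZMod (2S+1)`). [folklore] -/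
theorem reflectedPair_cylinder :
    ∀ (G : Type) [Group G] [TopologicalSpace G] [IsTopologicalGroup G] [CompactSpace G]
      [MeasurableSpace G] [BorelSpace G] (S rr : ℕ), rr + 2 ≤ 2 * S →
    ∀ (Y : LGConfig 4 G → ℝ) (B : ℝ), Measurable Y → (∀ U, |Y U| ≤ B) →
      DependsOn Y {e : Literature.MathematicalPhysics.QuantumLattice.ZdEdge 4 |
        1 ≤ e.1 0 ∧ e.1 0 + (if e.2 = 0 then 1 else 0) ≤ ((rr + 2 : ℕ) : ℤ)} →
    ∃ blk : (Fin (rr + 2) → GaugeConfig 3 (2 * S + 1) G) → (Fin (rr + 1) → Site 3 (2 * S + 1) → G) → ℝ,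
      Measurable (fun q : (Fin (rr + 2) → GaugeConfig 3 (2 * S + 1) G) × (Fin (rr + 1) → Site 3 (2 * S + 1) → G) => blk q.1 q.2) ∧
      (∀ W γs, |blk W γs| ≤ B) ∧
      (∀ (m : ℕ) (q : (ZMod (2 * S + 1) → GaugeConfig 3 (2 * S + 1) G) × (ZMod (2 * S + 1) → Site 3 (2 * S + 1) → G)),
        Y (configShift (-Pi.single 0 (m : ℤ)) (torusLift (2 * S + 1) (fun e : Edge 4 (2 * S + 1) =>
          (Fin.cons (q.2 (e.1 0) (Fin.tail e.1)) (fun i : Fin 3 => q.1 (e.1 0) (Fin.tail e.1, i)) : Fin 4 → G) e.2))) =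
        blk (fun i : Fin (rr + 2) => q.1 ((m + 1 + (i : ℕ) : ℕ) : ZMod (2 * S + 1)))
          (fun i : Fin (rr + 1) => q.2 ((m + 1 + (i : ℕ) : ℕ) : ZMod (2 * S + 1)))) ∧
      (∀ q : (ZMod (2 * S + 1) → GaugeConfig 3 (2 * S + 1) G) × (ZMod (2 * S + 1) → Site 3 (2 * S + 1) → G),
        Y (torusLift (2 * S + 1) (GaugeConfig.timeReflect (fun e : Edge 4 (2 * S + 1) =>
          (Fin.cons (q.2 (e.1 0) (Fin.tail e.1)) (fun i : Fin 3 => q.1 (e.1 0) (Fin.tail e.1, i)) : Fin 4 → G) e.2))) =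
        blk (fun i : Fin (rr + 2) => q.1 (-((i : ℕ) : ZMod (2 * S + 1))))
          (fun j : Fin (rr + 1) => fun y => (q.2 (-(((j : ℕ) + 1 : ℕ) : ZMod (2 * S + 1))) y)⁻¹)) := by
  intro G _ _ _ _ _ _ S rr hrr Y B hYm hYb hYd
  -- the assembling map, rotations of the time cycle, extension of a window, the block observable of `Y`
  obtain ⟨asm, hasm_def⟩ : ∃ asm : (ZMod (2 * S + 1) → GaugeConfig 3 (2 * S + 1) G) × (ZMod (2 * S + 1) → Site 3 (2 * S + 1) → G) →
      GaugeConfig 4 (2 * S + 1) G, asm = fun p => fun e : Edge 4 (2 * S + 1) =>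
        (Fin.cons (p.2 (e.1 0) (Fin.tail e.1)) (fun i : Fin 3 => p.1 (e.1 0) (Fin.tail e.1, i)) : Fin 4 → G) e.2 := ⟨_, rfl⟩
  obtain ⟨rot, hrot_def⟩ : ∃ rot : ZMod (2 * S + 1) →
      (ZMod (2 * S + 1) → GaugeConfig 3 (2 * S + 1) G) × (ZMod (2 * S + 1) → Site 3 (2 * S + 1) → G) →
      (ZMod (2 * S + 1) → GaugeConfig 3 (2 * S + 1) G) × (ZMod (2 * S + 1) → Site 3 (2 * S + 1) → G),
    rot = fun c₀ p => (fun τ => p.1 (τ + c₀), fun τ => p.2 (τ + c₀)) := ⟨_, rfl⟩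
  obtain ⟨ext0, hext0_def⟩ : ∃ ext0 : (Fin (rr + 2) → GaugeConfig 3 (2 * S + 1) G) × (Fin (rr + 1) → Site 3 (2 * S + 1) → G) →
      (ZMod (2 * S + 1) → GaugeConfig 3 (2 * S + 1) G) × (ZMod (2 * S + 1) → Site 3 (2 * S + 1) → G),
    ext0 = fun q => (fun τ => if h : τ.val < rr + 2 then q.1 ⟨τ.val, h⟩ else q.1 0,
      fun τ => if h : τ.val < rr + 1 then q.2 ⟨τ.val, h⟩ else q.2 0) := ⟨_, rfl⟩
  obtain ⟨blk, hblk_def⟩ : ∃ blk : (Fin (rr + 2) → GaugeConfig 3 (2 * S + 1) G) → (Fin (rr + 1) → Site 3 (2 * S + 1) → G) → ℝ,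
    blk = fun W γs => Y (torusLift (2 * S + 1) (asm (rot (-1) (ext0 (W, γs))))) := ⟨_, rfl⟩
  have hasm_meas : Measurable asm := by
    rw [hasm_def]
    refine measurable_pi_lambda _ fun e => ?_
    obtain ⟨x, μ⟩ := e
    cases μ using Fin.cases with
    | zero =>
      simp only [Fin.cons_zero]
      exact (measurable_pi_apply _).comp ((measurable_pi_apply _).comp measurable_snd)
    | succ i =>
      simp only [Fin.cons_succ]
      exact (measurable_pi_apply _).comp ((measurable_pi_apply _).comp measurable_fst)
  have hrot_meas : ∀ c₀, Measurable (rot c₀) := fun c₀ => by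
    rw [hrot_def]
    exact (measurable_pi_lambda _ fun τ => (measurable_pi_apply _).comp measurable_fst).prodMk
      (measurable_pi_lambda _ fun τ => (measurable_pi_apply _).comp measurable_snd)
  have hext0_meas : Measurable ext0 := by
    rw [hext0_def]
    refine (measurable_pi_lambda _ fun τ => ?_).prodMk (measurable_pi_lambda _ fun τ => ?_)
    · by_cases h : τ.val < rr + 2
      · simp only [h, dite_true]; exact (measurable_pi_apply _).comp measurable_fst
      · simp only [h, dite_false]; exact (measurable_pi_apply _).comp measurable_fst
    · by_cases h : τ.val < rr + 1
      · simp only [h, dite_true]; exact (measurable_pi_apply _).comp measurable_snd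
      · simp only [h, dite_false]; exact (measurable_pi_apply _).comp measurable_snd
  have hblk_meas : Measurable fun q : (Fin (rr + 2) → GaugeConfig 3 (2 * S + 1) G) × (Fin (rr + 1) → Site 3 (2 * S + 1) → G) =>
      blk q.1 q.2 := by
    rw [hblk_def]
    exact hYm.comp ((measurable_torusLift _).comp (hasm_meas.comp ((hrot_meas _).comp hext0_meas)))
  have hblkB : ∀ W γs, |blk W γs| ≤ B := fun W γs => by rw [hblk_def]; exact hYb _
  -- time coordinates of slab edges
  have hedge : ∀ e ∈ {e : Literature.MathematicalPhysics.QuantumLattice.ZdEdge 4 |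
        1 ≤ e.1 0 ∧ e.1 0 + (if e.2 = 0 then 1 else 0) ≤ ((rr + 2 : ℕ) : ℤ)},
      1 ≤ e.1 0 ∧ e.1 0 ≤ rr + 2 ∧ (e.2 = 0 → e.1 0 ≤ rr + 1) := by
    rintro ⟨x, μ⟩ ⟨h1, h2⟩
    simp only at h1 h2 ⊢
    refine ⟨h1, ?_, fun hμ => ?_⟩
    · by_cases hμ : μ = 0
      · simp only [hμ, ite_true] at h2; push_cast at h2; omega
      · simp only [hμ, ite_false] at h2; push_cast at h2; omega
    · simp only [hμ, ite_true] at h2; push_cast at h2; omega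
  -- small casts into `ZMod (2S+1)`
  have hval : ∀ z : ℤ, 1 ≤ z → z ≤ rr + 2 → ((z : ZMod (2 * S + 1)) - 1).val = (z - 1).toNat ∧ (z - 1).toNat < rr + 2 := by
    intro z hz1 hz2
    refine ⟨?_, by omega⟩
    have h := val_intCast_of_nonneg_lt (N := 2 * S + 1) (z - 1) (by omega) (by omega)
    rw [← h]; push_cast; ring_nf
  -- the cylinder property: `Y` and its translates / reflection in sliced coordinates
  have hcylS : ∀ (m : ℕ) (q : (ZMod (2 * S + 1) → GaugeConfig 3 (2 * S + 1) G) × (ZMod (2 * S + 1) → Site 3 (2 * S + 1) → G)),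
      Y (configShift (-Pi.single 0 (m : ℤ)) (torusLift (2 * S + 1) (asm q))) =
        blk (fun i : Fin (rr + 2) => q.1 ((m + 1 + (i : ℕ) : ℕ) : ZMod (2 * S + 1)))
          (fun i : Fin (rr + 1) => q.2 ((m + 1 + (i : ℕ) : ℕ) : ZMod (2 * S + 1))) := by
    intro m q
    simp only [hblk_def]
    apply hYd
    intro e he
    obtain ⟨he1, he2, he3⟩ := hedge e he
    obtain ⟨x, μ⟩ := e
    simp only at he1 he2 he3
    rw [configShift_apply, torusLift_apply, torusLift_apply]
    have htime : Literature.Probability.LatticeModels.Torus.proj (2 * S + 1) (x - -Pi.single 0 (m : ℤ)) 0 = ((x 0 : ℤ) : ZMod (2 * S + 1)) + (m : ZMod (2 * S + 1)) := by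
      show (((x - -Pi.single (0 : Fin 4) (m : ℤ) : Literature.Probability.LatticeModels.Site 4) 0 : ℤ) : ZMod (2 * S + 1)) = _
      rw [Pi.sub_apply, Pi.neg_apply, Pi.single_eq_same]
      push_cast
      ring
    have htail : Fin.tail (Literature.Probability.LatticeModels.Torus.proj (2 * S + 1) (x - -Pi.single 0 (m : ℤ))) = Fin.tail (Literature.Probability.LatticeModels.Torus.proj (2 * S + 1) x) := by
      funext i
      show (((x - -Pi.single (0 : Fin 4) (m : ℤ) : Literature.Probability.LatticeModels.Site 4) i.succ : ℤ) : ZMod (2 * S + 1)) = ((x i.succ : ℤ) : ZMod (2 * S + 1))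
      rw [Pi.sub_apply, Pi.neg_apply, Pi.single_eq_of_ne (Fin.succ_ne_zero i), neg_zero, sub_zero]
    have htime0 : Literature.Probability.LatticeModels.Torus.proj (2 * S + 1) x 0 = ((x 0 : ℤ) : ZMod (2 * S + 1)) := rfl
    obtain ⟨hv, hvlt⟩ := hval (x 0) he1 he2
    have hlt1 : μ = 0 → (((x 0 : ℤ) : ZMod (2 * S + 1)) - 1).val < rr + 1 := fun hμ => by rw [hv]; have := he3 hμ; omega
    have hlt2 : (((x 0 : ℤ) : ZMod (2 * S + 1)) - 1).val < rr + 2 := by rw [hv]; exact hvlt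
    have hidx : ((m + 1 + (((x 0 : ℤ) : ZMod (2 * S + 1)) - 1).val : ℕ) : ZMod (2 * S + 1)) =
        ((x 0 : ℤ) : ZMod (2 * S + 1)) + (m : ZMod (2 * S + 1)) := by
      push_cast
      rw [ZMod.natCast_zmod_val]
      ring
    simp only [hasm_def, hrot_def, hext0_def]
    cases μ using Fin.cases with
    | zero =>
      simp only [Fin.cons_zero]
      rw [htime, htail, htime0]
      rw [show ((x 0 : ℤ) : ZMod (2 * S + 1)) + (-1 : ZMod (2 * S + 1)) = ((x 0 : ℤ) : ZMod (2 * S + 1)) - 1 by ring,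
        dif_pos (hlt1 rfl), hidx]
    | succ i =>
      simp only [Fin.cons_succ]
      rw [htime, htail, htime0]
      rw [show ((x 0 : ℤ) : ZMod (2 * S + 1)) + (-1 : ZMod (2 * S + 1)) = ((x 0 : ℤ) : ZMod (2 * S + 1)) - 1 by ring,
        dif_pos hlt2, hidx]
  -- the reflected functional in sliced coordinates (block of `ΘY` = reversed block, temporal links inverted)
  have hcylR : ∀ q : (ZMod (2 * S + 1) → GaugeConfig 3 (2 * S + 1) G) × (ZMod (2 * S + 1) → Site 3 (2 * S + 1) → G),
      Y (torusLift (2 * S + 1) (GaugeConfig.timeReflect (asm q))) =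
        blk (fun i : Fin (rr + 2) => q.1 (-((i : ℕ) : ZMod (2 * S + 1))))
          (fun j : Fin (rr + 1) => fun y => (q.2 (-(((j : ℕ) + 1 : ℕ) : ZMod (2 * S + 1))) y)⁻¹) := by
    intro q
    simp only [hblk_def]
    apply hYd
    intro e he
    obtain ⟨he1, he2, he3⟩ := hedge e he
    obtain ⟨x, μ⟩ := e
    simp only at he1 he2 he3
    rw [torusLift_apply, torusLift_apply]
    obtain ⟨hv, hvlt⟩ := hval (x 0) he1 he2
    have hlt1 : μ = 0 → (((x 0 : ℤ) : ZMod (2 * S + 1)) - 1).val < rr + 1 := fun hμ => by rw [hv]; have := he3 hμ; omega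
    have hlt2 : (((x 0 : ℤ) : ZMod (2 * S + 1)) - 1).val < rr + 2 := by rw [hv]; exact hvlt
    have htime0 : Literature.Probability.LatticeModels.Torus.proj (2 * S + 1) x 0 = ((x 0 : ℤ) : ZMod (2 * S + 1)) := rfl
    simp only [hasm_def, hrot_def, hext0_def, GaugeConfig.timeReflect]
    cases μ using Fin.cases with
    | zero =>
      simp only [Fin.cons_zero, ite_true]
      -- left: the reversed temporal link at time `-x₀`; right: the inverted block fibre
      have hz0 : Site.timeReflect (Site.shift (Literature.Probability.LatticeModels.Torus.proj (2 * S + 1) x) 0) 0 =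
          -((x 0 : ℤ) : ZMod (2 * S + 1)) := by
        simp only [Site.timeReflect, Site.shift, Function.update_self, Pi.add_apply, Pi.single_eq_same, htime0]
        ring
      have hzt : Fin.tail (Site.timeReflect (Site.shift (Literature.Probability.LatticeModels.Torus.proj (2 * S + 1) x) 0)) =
          Fin.tail (Literature.Probability.LatticeModels.Torus.proj (2 * S + 1) x : Site 4 (2 * S + 1)) := by
        funext i
        simp only [Fin.tail, Site.timeReflect, Site.shift, Function.update_of_ne (Fin.succ_ne_zero i), Pi.add_apply,
          Pi.single_eq_of_ne (Fin.succ_ne_zero i), add_zero]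
      have hcond : Literature.Probability.LatticeModels.Torus.proj (2 * S + 1) x 0 + -1 =
          ((x 0 : ℤ) : ZMod (2 * S + 1)) - 1 := by rw [htime0]; ring
      have hlt1' : (Literature.Probability.LatticeModels.Torus.proj (2 * S + 1) x 0 + -1).val < rr + 1 := by
        rw [hcond]; exact hlt1 rfl
      rw [hz0, hzt, dif_pos hlt1']
      show _ = (q.2 _ (Fin.tail (Literature.Probability.LatticeModels.Torus.proj (2 * S + 1) x)))⁻¹
      congr 3
      push_cast
      rw [ZMod.natCast_zmod_val, htime0]
      ring
    | succ i =>
      simp only [Fin.cons_succ, Fin.succ_ne_zero, ite_false]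
      have hz0 : Site.timeReflect (Literature.Probability.LatticeModels.Torus.proj (2 * S + 1) x : Site 4 (2 * S + 1)) 0 =
          1 - ((x 0 : ℤ) : ZMod (2 * S + 1)) := by
        simp only [Site.timeReflect, Function.update_self, htime0]
      have hzt : Fin.tail (Site.timeReflect (Literature.Probability.LatticeModels.Torus.proj (2 * S + 1) x : Site 4 (2 * S + 1))) =
          Fin.tail (Literature.Probability.LatticeModels.Torus.proj (2 * S + 1) x : Site 4 (2 * S + 1)) := by
        funext j
        simp only [Fin.tail, Site.timeReflect, Function.update_of_ne (Fin.succ_ne_zero j)]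
      have hcond : Literature.Probability.LatticeModels.Torus.proj (2 * S + 1) x 0 + -1 =
          ((x 0 : ℤ) : ZMod (2 * S + 1)) - 1 := by rw [htime0]; ring
      have hlt2' : (Literature.Probability.LatticeModels.Torus.proj (2 * S + 1) x 0 + -1).val < rr + 2 := by
        rw [hcond]; exact hlt2
      rw [hz0, hzt, dif_pos hlt2', ZMod.natCast_zmod_val, htime0]
      ring_nf
  refine ⟨blk, hblk_meas, hblkB, fun m q => ?_, fun q => ?_⟩
  · have h := hcylS m q
    rw [hasm_def] at h
    exact h
  · have h := hcylR q
    rw [hasm_def] at h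
    exact h

end Summit.QuantumFields.YangMills.Theorems.WeakCouplingHypercubicLimit.TraceNormColdPressure

end
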